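import Literature.MathematicalPhysics.QuantumFieldTheory.Balaban1983to89.InfiniteVolumeSufficientXVIII
import Literature.MathematicalPhysics.QuantumLattice.WilsonLoopsProofs
import HarnessLib

/-!
# Sufficient conditions for the infinite-volume limit, XIX — THE GAUGE-INVARIANT OBSERVABLE CLASS AND THE
WILSON-LOOP CORRELATIONS

Module XIX of the `Balaban1983to89` audit package (infinite-volume angle: what uniformity in the volume the
renormalisation-group bounds of [Bal83–89] do and do not give, and the exact missing estimate).  A LEAF above the
PART I capstone (module XVIII); it also imports the tree's Wilson-loop file `QuantumLattice.WilsonLoopsProofs`.  It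
answers census item §23.3 (d)(vi) of `ir/SUFFICIENT.md`: IS THE TARGET `(3a)` WEAKENED BY RESTRICTING IT TO THE
GAUGE-INVARIANT (physical) OBSERVABLES, AND WHICH EXPECTATIONS EXACTLY MUST CONVERGE?  Nothing is cited as a fact:
every statement below is a theorem over the tree's definitions, or a `Prop`-valued schema used only as a hypothesis
(ABSOLUTE RULE of the package: no internally minted statement enters as a cited fact; `[cite: …]` tags mark the SHAPE
or STATUS of a statement in print, never a borrowed proof step).  Every kernel statement holds at every real `β`,
every dimension `d`, every compact metrisable group `G` (Hausdorff where limit points occur) and every continuous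
finite-dimensional representation `ρ`.

## (1) GAUGE CALCULUS ON `ℤ^d` AND THE TORUS DICTIONARY (`PART A`)

`cylVertices S` (the vertices an `S`-cylinder can see); locality of the gauge action
(`gaugeTransformZd_congr_of_isCylinder`: `F(U^k)` depends on `k` only through `k|_{vertices(S)}`); `gaugeExt V g`
(extension by `1`); the periodic lift INTERTWINES the two gauge actions (`torusLift_gaugeTransform`:
`lift(W^γ) = lift(W)^{γ ∘ proj}`); a gauge function on a finite `V ⊂ ℤ^d` induces one on every torus into which `V`
projects injectively (`torusGauge`, `eventually_injOn_torusProj_sites`), and then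
`toTorusObservable_comp_gaugeTransformZd`: the torus restriction of `F ∘ (U ↦ U^{ext g})` IS the torus restriction of
`F` composed with a TORUS gauge transformation.  With the tree's gauge invariance of the Wilson measure
(`wilsonMeasure_map_gaugeTransform_holds`, Wilson 1974 §III.B) this gives
`wilsonExpectation_toTorusObservable_comp_gaugeTransformZd`: `⟨F ∘ (U ↦ U^k)⟩_{𝕋_L,β} = ⟨F⟩_{𝕋_L,β}` for every
`S`-cylinder `F`, EVERY `k : ℤ^d → G` (periodic or not) and every torus into which the vertices of `S` project
injectively — in particular for all large `L` (`eventually_wilsonExpectation_comp_gaugeTransformZd`).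

## (2) THE GAUGE AVERAGE (`PART B`)

`gaugeAvg V F (U) = ∫_{G^V} F(U^{ext g}) dg` (product of normalised Haar measures over the finite vertex set `V`):
bounded by the bound of `F` (`abs_gaugeAvg_le`), an `S`-cylinder if `F` is (`isCylinder_gaugeAvg`), measurable /
continuous if `F` is (`measurable_gaugeAvg`, `continuous_gaugeAvg`: Fubini measurability, resp. a parametric integral
of a jointly continuous integrand over a compact group), GAUGE INVARIANT as soon as `V ⊇ vertices(S)`
(`isZdGaugeInvariant_gaugeAvg`: locality + right invariance of Haar measure on `G^V`), equal to `F` if `F` is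
invariant (`gaugeAvg_of_isZdGaugeInvariant`); and Fubini: a gauge-invariant probability measure does not distinguish
`F` from `Av F` (`integral_gaugeAvg_eq`).

## (3) THE HEADLINES (`PARTS C–E`)

* `wilsonExpectation_toTorusObservable_gaugeAvg`: `⟨Av F⟩_{𝕋_L,β} = ⟨F⟩_{𝕋_L,β}` for every bounded measurable
  `S`-cylinder and every large torus (Fubini + (1)).
* HEADLINE 1 `hasGaugeInvariantTorusLimits_iff_hasTorusLimits`: the schema `(3)⁰_ginv = HasGaugeInvariantTorusLimits`
  (every GAUGE-INVARIANT bounded measurable local observable has a thermodynamic limit along the tori) is EQUIVALENT to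
  the tree's `HasTorusLimits` (all bounded measurable local observables).  HEADLINE 2
  `hasUniqueInfiniteVolumeLimit_iff_hasGaugeInvariantTorusLimits`: `(3a) ⟺ (3)⁰_ginv`;
  `hasGaugeInvariantTorusLimits_iff_condDensityTVCauchy`: `(3)⁰_ginv` joins module XVIII's ONE-TARGET list.
* `map_gaugeTransformZd_of_mem_infiniteVolumeLimitPoints`: every infinite-volume limit point of the torus states is
  gauge invariant under ALL `k : ℤ^d → G`; `measure_eq_of_integral_gaugeInvariant_eq`: gauge-invariant probability
  measures on `G^{edges(ℤ^d)}` are determined by the gauge-invariant bounded continuous cylinder observables (the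
  averaging argument of Sengupta 1994 Thm 4, typed on the infinite lattice); HEADLINE 3
  `hasUniqueInfiniteVolumeLimit_iff_limitPoints_agree_gaugeInvariant`: `(3a)` iff all limit points agree on that class.
* HEADLINE 4 `hasUniqueInfiniteVolumeLimit_iff_tendsto_of_spans` — DENSE-CLASS REDUCTION: for any class `𝒲` of bounded
  measurable local observables whose real span is uniformly dense in the gauge-invariant bounded continuous cylinders
  (schema `SpansGaugeInvariantCylinders d 𝒲`, a HYPOTHESIS), `(3a)` holds iff every member of `𝒲` has a thermodynamic
  limit of its torus expectations.

## (4) THE WILSON-LOOP DICTIONARY (`PART F`)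

`loopFactor ρ (ℓ, b)` (`Re`/`Im tr ρ(U_ℓ)` for a loop `ℓ` = closed walk of the tree's `zdGraph d`, via the tree's
`wilsonLoopObs`), `loopProduct ρ l` (finite products), `wilsonLoopProducts ρ d` (their set: local, continuous, bounded
for continuous `ρ`); the schema `(W-corr) = HasWilsonLoopCorrelationLimits ρ d β` (every loop CORRELATION
`⟨∏ᵢ Re/Im tr ρ(U_{ℓᵢ})⟩_{𝕋_{L+1},β}` converges); `hasWilsonLoopCorrelationLimits_of_hasUniqueInfiniteVolumeLimit`
(`(3a) ⟹ (W-corr)`, unconditionally); `hasUniqueInfiniteVolumeLimit_iff_hasWilsonLoopCorrelationLimits`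
(`(3a) ⟺ (W-corr)` under the hypothesis `SpansGaugeInvariantCylinders d (wilsonLoopProducts ρ d)` — the SHAPE of
Lévy 2004 (Abstract, second sentence: for `G` orthogonal `O(n)`, unitary or symplectic the Wilson loops of the natural
representation are enough; Thm 3.1 itself is stated with the Wilson loops of ALL finite-dimensional representations,
for `G` a finite product of `U(n), SU(n), O(n), SO(n), Sp(n)`) and of Sengupta 1994 Thm 2 (`U(n), SU(n), O(n),
SO(2n+1)`), for ONE representation `ρ` = the natural one, transported to cylinder observables of `ℤ^d`; NOT formalised
here.  v1.1 PRECISION (XREAD D1): for the special orthogonal groups `SO(2n)` in their natural representation this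
hypothesis is FALSE for `d ≥ 2` — conjugating every link by one reflection `r ∈ O(2n) ∖ SO(2n)` fixes every
natural-representation loop trace but moves the `SO(2n)`-class of a plaquette holonomy; kernel witness for
`SO(2) ≅ U(1)`: module XX, `not_spansGaugeInvariantCylinders_so2Rep` — so there the two Wilson-loop iffs below are
vacuous and all irreducible characters are needed, as in Thm 3.1; for `U(1)` with its defining representation the
hypothesis is PROVED in module XX); `hasWilsonLoopCorrelationLimits_iff_cauchySeq` (the volume-Cauchy form).

CENSUS (what this says about the missing estimate, and why weaker versions do not suffice).
(a) Restricting `(3)⁰` to gauge-invariant observables is NOT a weakening for periodic boundary conditions (HEADLINE 1):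
    the torus states are gauge invariant, so `⟨F⟩` and `⟨Av F⟩` agree in every large volume.  "Only gauge-invariant
    quantities need converge" buys nothing; the one wall of module XVIII (`(D_B^{TV,0}) ⟺ (3a)`) stands unchanged.
(b) In loop language what must converge is the family of JOINT MOMENTS of the Wilson loops (loop correlations,
    `(W-corr)`), under a density hypothesis on the ALGEBRA they generate.  The linear span of the single-loop functions
    `U ↦ tr ρ(U_ℓ)` is not closed under products when `N ≥ 2` (`tr A · tr B` is not the trace of a holonomy), and nothing
    is derived here from the convergence of single-loop expectations alone; for abelian `G` (`N = 1`) products of loops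
    joined to a common base point are loops, so there the distinction disappears (remark, not formalised).
(c) The density hypothesis cannot be dropped from HEADLINE 4 as typed: for `𝒲 = {constants}` its right-hand side holds at
    every `β`, while its left-hand side is the uniqueness question which is OPEN in `d ≥ 3` at large `β` (Chatterjee
    2018 §2 p. 5: "the uniqueness (or non-uniqueness) is in general unknown for lattice gauge theories in dimensions
    higher than two when `β` is large"); an unconditional HEADLINE 4 would decide it.
(d) Bounds UNIFORM in the volume on loop correlations are free (`exists_abs_loopProduct_le`) and give subsequential limits
    only (module XVIII PART B: strong compactness and nothing more).  `(W-corr)` is CONVERGENCE, i.e. CAUCHY IN THE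
    VOLUME (`hasWilsonLoopCorrelationLimits_iff_cauchySeq`): the exact missing input in loop language is an estimate
    `|⟨W⟩_{𝕋_L,β} - ⟨W⟩_{𝕋_{L'},β}| ≤ ε_W(min(L, L')) → 0` for every loop correlation `W` — an INTER-VOLUME comparison,
    which bounds of the type [Bal89, (0.1)] (uniform in the lattice spacing and the volume) are not (module XVIII census).
(e) Continuity in the density schema versus measurability in `(3)⁰_ginv` is no gap: limit points are Borel probability
    measures determined by their continuous cylinder integrals (tree, `measure_eq_of_integral_cylinder_eq`).

STATUS MARKERS (sources; search log, labelled).  [corpus:paper:arxiv-1803.01950 p.5] Chatterjee 2018 §2 (the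
infinite-volume limit "may or may not be unique"; uniqueness unknown for `d > 2`, `β` large) — quoted in (c).
[corpus:paper:doi-10-1090-s0002-9939-1994-1215205-7 pp.897, 903–904] Sengupta 1994, Thm 4: for compact `G` in his list
a gauge-invariant Yang–Mills measure is determined by the expectations of PRODUCTS of characters of holonomies
(averaging over the gauge group + Stone–Weierstrass); Thm 2 there (and Durhuus 1980, Lett. Math. Phys. 4, 515–522,
his reference [Du]; also Montvay–Münster 1994 p. 422) is the underlying invariant theory — the finite-dimensional
mechanism of `measure_eq_of_integral_gaugeInvariant_eq` and HEADLINE 4, used here on the infinite lattice with the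
thermodynamic limit as the question.  [corpus:paper:arxiv-math-ph_0306059 p.5] Lévy 2004 Thm 3.1 (for `G` a finite
product of `U(n), SU(n), O(n), SO(n), Sp(n)` and any finite graph, the algebra generated by the Wilson loops
`W_{α,l} = χ_α ∘ h_l` of ALL finite-dimensional representations `α` is dense in `C(G^E/G^V)`) together with
[corpus:paper:arxiv-math-ph_0306059 p.2] its Abstract, second sentence («If `G` is orthogonal, unitary or symplectic,
then Wilson loops associated to the natural representation of `G` are enough») and
[corpus:paper:doi-10-1090-s0002-9939-1994-1215205-7 p.897] Sengupta 1994 Thm 2 (`U(n)`, `SU(n)`, `O(n)`, `SO(2n+1)`,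
abelian groups) — the SHAPE of the hypothesis of `hasUniqueInfiniteVolumeLimit_iff_hasWilsonLoopCorrelationLimits` for
ONE (the natural) representation; v1.1: NOT for `SO(2n)` in its natural representation (v1 wrote `SO(n)` here; XREAD
D1, certificate `XREAD-InfiniteVolumeSufficientXIX-v1.md` of seat strat-g18).
Galaxy `--star all` "gauge-invariant observables|gauge invariant functions|Wilson loop functionals" and "gauge invariant
classical observables|Gauge invariant functions of connections|products of Wilson loops", `--star pdf` "Spin networks in
gauge theory|Gauge invariant functions of connections|Wilson loops determine": no treatment of the THERMODYNAMIC LIMIT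
through the gauge-invariant class beyond the above (related hits: Lévy's two-dimensional Yang–Mills texts
[galaxy:pdf:436350313474847060], [galaxy:pdf:1150792360]; Hamiltonian finite-group lattice theory
[galaxy:pdf:3006863240]); corpus hybrid "gauge invariant observables Wilson loops expectation thermodynamic limit
lattice gauge theory": textbooks only (Montvay–Münster 1994 pp. 122–149, Greensite 2011).  Sibling: the slice-torus
gauge average `gaugeAverage` of `MassGapGaugeInvariantClass` (mass-gap clause, `GaugeConfig 3 L G`, all vertices of a
finite torus) is a different object; nothing of it is reused, no name is duplicated.  Nothing about the gauge theory at
weak coupling is claimed.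

VERSIONS.  v1 (gen 19 of seat IR-1).  v1.1 (gen 20; additive DOCFIX D1 of XREAD C-strat18-4, docstrings only — four
passages over-read Lévy 2004 as «natural representation for `U(n), SU(n), O(n), SO(n), Sp(n)`»; corrected to the
Abstract's `O(n)`/`U(n)`/`Sp(n)` (+ `SU(n)`, `SO(2n+1)`; Sengupta 1994 Thm 2), Thm 3.1 being with all representations,
`SO(2n)`-natural excluded; no declaration of v1 changed).
-/

namespace Literature.MathematicalPhysics.QuantumFieldTheory

open MeasureTheory Filter Topology
open Literature.MathematicalPhysics.QuantumLattice
open Literature.Probability.LatticeModels (Torus.proj zdGraph)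
open Balaban1983to89.Missing (HasCondDensityTVCauchy)

-- Sites of `ℤ^d` are written `Fin d → ℤ` (= the tree's `Literature.Probability.LatticeModels.Site d`, an `abbrev`); the
-- unqualified `Site d L` of this namespace is the discrete torus `(ℤ/Lℤ)^d` of Wave 0.

/-! ## PART A — GAUGE CALCULUS ON `ℤ^d` AND ITS TORUS DICTIONARY -/

section GaugeCalculus

variable {d : ℕ} {G : Type*} [Group G]

/-- Gauge transformations of `ℤ^d` compose: `(U^h)^g = U^{g h}` (Seiler LNP 159 Ch. 1). [folklore] -/
theorem gaugeTransformZd_gaugeTransformZd (g h : (Fin d → ℤ) → G) (U : LGConfig d G) :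
    gaugeTransformZd g (gaugeTransformZd h U) = gaugeTransformZd (g * h) U := by
  funext e
  simp only [gaugeTransformZd, Pi.mul_apply, mul_inv_rev, mul_assoc]

/-- The trivial gauge transformation acts trivially. [folklore] -/
@[simp] theorem gaugeTransformZd_one (U : LGConfig d G) : gaugeTransformZd (1 : (Fin d → ℤ) → G) U = U := by
  funext e
  simp [gaugeTransformZd]

/-- The vertices touched by a finite edge set `S ⊂ edges(ℤ^d)`: the endpoints `x` and `x + eᵢ` of its edges
`(x, i)` — the finite part of the gauge group that a cylinder observable with support `S` can see. [folklore] -/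
def cylVertices (S : Finset (ZdEdge d)) : Finset (Fin d → ℤ) :=
  S.image Prod.fst ∪ S.image fun e => e.1 + Pi.single e.2 1

omit [Group G] in
/-- The base point of an edge of `S` is a vertex of `S`. [folklore] -/
theorem fst_mem_cylVertices {S : Finset (ZdEdge d)} {e : ZdEdge d} (he : e ∈ S) : e.1 ∈ cylVertices S :=
  Finset.mem_union.2 (Or.inl (Finset.mem_image_of_mem _ he))

omit [Group G] in
/-- The end point of an edge of `S` is a vertex of `S`. [folklore] -/
theorem shift_mem_cylVertices {S : Finset (ZdEdge d)} {e : ZdEdge d} (he : e ∈ S) :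
    e.1 + Pi.single e.2 1 ∈ cylVertices S :=
  Finset.mem_union.2 (Or.inr (Finset.mem_image.2 ⟨e, he, rfl⟩))

/-- **Locality of the gauge action.** A cylinder observable sees a gauge transformation only through its values
on the vertices of its support. [folklore] -/
theorem gaugeTransformZd_congr_of_isCylinder {α : Type*} {F : LGConfig d G → α} {S : Finset (ZdEdge d)}
    (hF : IsCylinder F S) {k₁ k₂ : (Fin d → ℤ) → G} (h : ∀ x ∈ cylVertices S, k₁ x = k₂ x) (U : LGConfig d G) :
    F (gaugeTransformZd k₁ U) = F (gaugeTransformZd k₂ U) :=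
  hF fun e he => by
    simp only [gaugeTransformZd, h _ (fst_mem_cylVertices (Finset.mem_coe.1 he)),
      h _ (shift_mem_cylVertices (Finset.mem_coe.1 he))]

/-- Gauge transformations act support-wise: `F ∘ (U ↦ U^k)` is a cylinder observable with the same support. [folklore] -/
theorem isCylinder_comp_gaugeTransformZd {α : Type*} {F : LGConfig d G → α} {S : Finset (ZdEdge d)}
    (hF : IsCylinder F S) (k : (Fin d → ℤ) → G) : IsCylinder (F ∘ gaugeTransformZd k) S :=
  fun U U' hUU' => hF fun e he => by simp only [gaugeTransformZd, hUU' e he]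

/-- Extension by `1` of a gauge transformation given on a finite vertex set `V ⊂ ℤ^d`. [folklore] -/
def gaugeExt (V : Finset (Fin d → ℤ)) (g : ↥V → G) : (Fin d → ℤ) → G := fun x => if h : x ∈ V then g ⟨x, h⟩ else 1

/-- `gaugeExt` on `V`. [folklore] -/
@[simp] theorem gaugeExt_of_mem {V : Finset (Fin d → ℤ)} (g : ↥V → G) {x : Fin d → ℤ} (h : x ∈ V) :
    gaugeExt V g x = g ⟨x, h⟩ := dif_pos h

/-- `gaugeExt` off `V`. [folklore] -/
@[simp] theorem gaugeExt_of_not_mem {V : Finset (Fin d → ℤ)} (g : ↥V → G) {x : Fin d → ℤ} (h : x ∉ V) :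
    gaugeExt V g x = 1 := dif_neg h

/-- `F(U^k) = F(U^{ext(k|_V)})` for a cylinder observable whose support has its vertices in `V`. [folklore] -/
theorem gaugeTransformZd_eq_gaugeExt_of_isCylinder {α : Type*} {F : LGConfig d G → α} {S : Finset (ZdEdge d)}
    (hF : IsCylinder F S) {V : Finset (Fin d → ℤ)} (hSV : cylVertices S ⊆ V) (k : (Fin d → ℤ) → G) (U : LGConfig d G) :
    F (gaugeTransformZd k U) = F (gaugeTransformZd (gaugeExt V fun x : ↥V => k x) U) :=
  gaugeTransformZd_congr_of_isCylinder hF (fun x hx => by rw [gaugeExt_of_mem _ (hSV hx)]) U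

/-! ### The torus dictionary -/

/-- **The periodic lift intertwines the gauge actions**: lifting the torus configuration `W^γ` to `ℤ^d` gives the
`ℤ^d` gauge transform of the lift of `W` by the periodic gauge function `γ ∘ proj` (Seiler LNP 159 Ch. 2, periodic
boundary conditions). [folklore] -/
theorem torusLift_gaugeTransform (L : ℕ) (γ : Site d L → G) (W : GaugeConfig d L G) :
    torusLift L (gaugeTransform γ W) = gaugeTransformZd (γ ∘ Torus.proj L) (torusLift L W) := by
  funext e
  simp only [torusLift, Function.comp_apply, torusEdge, gaugeTransform, gaugeTransformZd, Site.shift,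
    torusProj_add_single, Int.cast_one]

/-- The torus gauge function induced by `g : V → G` on a torus `(ℤ/Lℤ)^d`: `γ(proj x) = g(x)` for `x ∈ V` (when
`proj` is injective on `V`), `γ = 1` off `proj(V)`. [folklore] -/
noncomputable def torusGauge (L : ℕ) (V : Finset (Fin d → ℤ)) (g : ↥V → G) : Site d L → G :=
  Function.extend (fun x : ↥V => Torus.proj L (x : Fin d → ℤ)) g fun _ => 1

/-- `torusGauge L V g (proj x) = g x` for `x ∈ V` when `proj` is injective on `V`. [folklore] -/
theorem torusGauge_proj {L : ℕ} {V : Finset (Fin d → ℤ)} (hinj : Set.InjOn (Torus.proj (d := d) L) (V : Set (Fin d → ℤ)))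
    (g : ↥V → G) (x : ↥V) : torusGauge L V g (Torus.proj L (x : Fin d → ℤ)) = g x :=
  (show Function.Injective fun x : ↥V => Torus.proj L (x : Fin d → ℤ) from
    fun x y hxy => Subtype.ext (hinj x.2 y.2 hxy)).extend_apply g (fun _ => 1) x

/-- **KEY DICTIONARY ENTRY.** On a torus into which the vertices `V ⊇ vertices(S)` project injectively, the torus
restriction of `F ∘ (U ↦ U^{ext g})` (`F` an `S`-cylinder, `g : V → G`) IS the torus restriction of `F` composed
with the TORUS gauge transformation by `torusGauge L V g`. [folklore] -/
theorem toTorusObservable_comp_gaugeTransformZd {α : Type*} {F : LGConfig d G → α} {S : Finset (ZdEdge d)}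
    (hF : IsCylinder F S) {V : Finset (Fin d → ℤ)} (hSV : cylVertices S ⊆ V) {L : ℕ}
    (hinj : Set.InjOn (Torus.proj (d := d) L) (V : Set (Fin d → ℤ))) (g : ↥V → G) :
    toTorusObservable L (F ∘ gaugeTransformZd (gaugeExt V g)) =
      toTorusObservable L F ∘ gaugeTransform (torusGauge L V g) := by
  funext W
  simp only [toTorusObservable, Function.comp_apply, torusLift_gaugeTransform]
  exact gaugeTransformZd_congr_of_isCylinder hF (fun x hx => by
    rw [gaugeExt_of_mem _ (hSV hx), Function.comp_apply]
    exact (torusGauge_proj hinj g ⟨x, hSV hx⟩).symm) _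

omit [Group G] in
/-- A finite set of vertices of `ℤ^d` projects injectively into all large tori (the vertex version of the tree's
`eventually_injOn_torusEdge`; the name `eventually_injOn_torusProj` is the tree's plaquette version). [folklore] -/
theorem eventually_injOn_torusProj_sites (V : Finset (Fin d → ℤ)) :
    ∀ᶠ L : ℕ in atTop, Set.InjOn (Torus.proj (d := d) (L + 1)) (V : Set (Fin d → ℤ)) := by
  set R : ℕ := (V ×ˢ V).sup fun q => Finset.univ.sup fun k : Fin d => (q.1 k - q.2 k).natAbs with hR
  refine Filter.eventually_atTop.2 ⟨R, fun L hL => ?_⟩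
  intro x hx y hy hxy
  funext k
  have hk : ((x k : ℤ) : ZMod (L + 1)) = ((y k : ℤ) : ZMod (L + 1)) := by
    have := congr_fun hxy k
    simpa [Literature.Probability.LatticeModels.Torus.proj_apply] using this
  rw [ZMod.intCast_eq_intCast_iff_dvd_sub] at hk
  have hle : (x k - y k).natAbs ≤ R := by
    have hq : (x, y) ∈ V ×ˢ V := Finset.mem_product.2 ⟨hx, hy⟩
    have h1 : (x k - y k).natAbs ≤ Finset.univ.sup fun k : Fin d =>
        (((x, y) : (Fin d → ℤ) × (Fin d → ℤ)).1 k - ((x, y) : (Fin d → ℤ) × (Fin d → ℤ)).2 k).natAbs :=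
      Finset.le_sup (f := fun k : Fin d =>
        (((x, y) : (Fin d → ℤ) × (Fin d → ℤ)).1 k - ((x, y) : (Fin d → ℤ) × (Fin d → ℤ)).2 k).natAbs) (Finset.mem_univ k)
    exact h1.trans (Finset.le_sup (f := fun q : (Fin d → ℤ) × (Fin d → ℤ) =>
      Finset.univ.sup fun k : Fin d => (q.1 k - q.2 k).natAbs) hq)
  have hlt : |y k - x k| < ((L + 1 : ℕ) : ℤ) := by
    rw [abs_sub_comm, Int.abs_eq_natAbs]
    exact Int.ofNat_lt.2 (Nat.lt_succ_of_le (hle.trans hL))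
  have h0 : y k - x k = 0 := Int.eq_zero_of_abs_lt_dvd hk hlt
  linarith

/-! ### Gauge invariance of the torus states, in the `ℤ^d` dictionary -/

variable [TopologicalSpace G] [IsTopologicalGroup G] [CompactSpace G] [MeasurableSpace G] [BorelSpace G]
  {N : ℕ} (ρ : G →* Matrix (Fin N) (Fin N) ℂ)

/-- The torus gauge transformation `W ↦ W^γ` as a measurable equivalence (inverse `W ↦ W^{γ⁻¹}`). [folklore] -/
def torusGaugeEquiv {L : ℕ} [NeZero L] (γ : Site d L → G) : GaugeConfig d L G ≃ᵐ GaugeConfig d L G where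
  toFun := gaugeTransform γ
  invFun := gaugeTransform γ⁻¹
  left_inv U := funext fun e => by simp [gaugeTransform, mul_assoc]
  right_inv U := funext fun e => by simp [gaugeTransform, mul_assoc]
  measurable_toFun := (WilsonGauge.measurePreserving_gaugeTransform γ).measurable
  measurable_invFun := (WilsonGauge.measurePreserving_gaugeTransform γ⁻¹).measurable

/-- **Torus Wilson expectations are gauge invariant**: `⟨H ∘ (W ↦ W^γ)⟩_{Λ,β} = ⟨H⟩_{Λ,β}` for every observable
`H`, every `γ : Λ → G`, every real `β` (the tree's `wilsonMeasure_map_gaugeTransform_holds`, Wilson 1974 §III.B,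
changed into an integral identity along the measurable equivalence `torusGaugeEquiv`). [cite: Wilson1974, §III.B (3.27)-(3.29)] -/
theorem wilsonExpectation_comp_gaugeTransform {L : ℕ} [NeZero L] {E : Type*} [NormedAddCommGroup E]
    [NormedSpace ℝ E] (β : ℝ) (γ : Site d L → G) (H : GaugeConfig d L G → E) :
    wilsonExpectation ρ β (H ∘ gaugeTransform γ) = wilsonExpectation ρ β H := by
  have hmap : (wilsonMeasure ρ β).map (gaugeTransform γ) = wilsonMeasure (d := d) (L := L) ρ β :=
    (wilsonMeasure_map_gaugeTransform_holds (d := d) (L := L) ρ) β γ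
  unfold wilsonExpectation
  conv_rhs => rw [← hmap]
  exact (integral_map_equiv (torusGaugeEquiv γ) H).symm

/-- **Finite-volume gauge invariance in the `ℤ^d` dictionary.** For an `S`-cylinder `F` and ANY `k : ℤ^d → G`,
the torus expectation of `F ∘ (U ↦ U^k)` equals that of `F` as soon as the vertices of `S` project injectively into
the torus. [cite: Wilson1974, §III.B (3.27)-(3.29)] -/
theorem wilsonExpectation_toTorusObservable_comp_gaugeTransformZd {L : ℕ} [NeZero L] {E : Type*}
    [NormedAddCommGroup E] [NormedSpace ℝ E] (β : ℝ) {F : LGConfig d G → E} {S : Finset (ZdEdge d)}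
    (hF : IsCylinder F S) (hinj : Set.InjOn (Torus.proj (d := d) L) (cylVertices S : Set (Fin d → ℤ))) (k : (Fin d → ℤ) → G) :
    wilsonExpectation ρ β (toTorusObservable L (F ∘ gaugeTransformZd k)) =
      wilsonExpectation ρ β (toTorusObservable L F) := by
  have h1 : F ∘ gaugeTransformZd k =
      F ∘ gaugeTransformZd (gaugeExt (cylVertices S) fun x : ↥(cylVertices S) => k x) :=
    funext fun U => gaugeTransformZd_eq_gaugeExt_of_isCylinder hF subset_rfl k U
  rw [h1, toTorusObservable_comp_gaugeTransformZd hF subset_rfl hinj, wilsonExpectation_comp_gaugeTransform]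

/-- The same, for all large tori `𝕋_{L+1}`. [cite: Wilson1974, §III.B (3.27)-(3.29)] -/
theorem eventually_wilsonExpectation_comp_gaugeTransformZd {E : Type*} [NormedAddCommGroup E] [NormedSpace ℝ E]
    (β : ℝ) {F : LGConfig d G → E} {S : Finset (ZdEdge d)} (hF : IsCylinder F S) (k : (Fin d → ℤ) → G) :
    ∀ᶠ L : ℕ in atTop, wilsonExpectation (L := L + 1) ρ β (toTorusObservable (L + 1) (F ∘ gaugeTransformZd k)) =
      wilsonExpectation (L := L + 1) ρ β (toTorusObservable (L + 1) F) :=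
  (eventually_injOn_torusProj_sites (cylVertices S)).mono fun _ hL =>
    wilsonExpectation_toTorusObservable_comp_gaugeTransformZd ρ β hF hL k

end GaugeCalculus

/-! ## PART B — THE GAUGE AVERAGE OVER THE VERTICES OF A SUPPORT -/

section GaugeAverage

variable {d : ℕ} {G : Type*} [Group G] [TopologicalSpace G] [IsTopologicalGroup G]

/-- The gauge action of `ℤ^d` is continuous in the configuration. [folklore] -/
theorem continuous_gaugeTransformZd (k : (Fin d → ℤ) → G) : Continuous (gaugeTransformZd (G := G) k) :=
  continuous_pi fun e => by
    show Continuous fun U : LGConfig d G => k e.1 * U e * (k (e.1 + Pi.single e.2 1))⁻¹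
    exact (continuous_const.mul (continuous_apply e)).mul continuous_const

/-- Joint continuity of `(U, g) ↦ U^{ext g}` on `G^{edges(ℤ^d)} × G^V`. [folklore] -/
theorem continuous_gaugeAction (V : Finset (Fin d → ℤ)) :
    Continuous fun p : LGConfig d G × (↥V → G) => gaugeTransformZd (gaugeExt V p.2) p.1 := by
  have hx : ∀ x : Fin d → ℤ, Continuous fun p : LGConfig d G × (↥V → G) => gaugeExt V p.2 x := fun x => by
    by_cases h : x ∈ V
    · simp only [gaugeExt, dif_pos h]
      exact (continuous_apply _).comp continuous_snd
    · simp only [gaugeExt, dif_neg h]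
      exact continuous_const
  refine continuous_pi fun e => ?_
  show Continuous fun p : LGConfig d G × (↥V → G) =>
    gaugeExt V p.2 e.1 * p.1 e * (gaugeExt V p.2 (e.1 + Pi.single e.2 1))⁻¹
  exact ((hx e.1).mul ((continuous_apply e).comp continuous_fst)).mul (hx _).inv

variable [MeasurableSpace G] [BorelSpace G]

/-- The gauge action is measurable in the configuration (coordinatewise; no countability assumption). [folklore] -/
theorem measurable_gaugeTransformZd (k : (Fin d → ℤ) → G) : Measurable (gaugeTransformZd (G := G) k) :=
  measurable_pi_lambda _ fun e => by
    show Measurable fun U : LGConfig d G => k e.1 * U e * (k (e.1 + Pi.single e.2 1))⁻¹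
    exact ((measurable_pi_apply e : Measurable fun U : LGConfig d G => U e).const_mul (k e.1)).mul_const _

/-- The gauge transformation `U ↦ U^k` of `G^{edges(ℤ^d)}` as a measurable equivalence (inverse `U ↦ U^{k⁻¹}`).
[folklore] -/
def gaugeEquivZd (k : (Fin d → ℤ) → G) : LGConfig d G ≃ᵐ LGConfig d G where
  toFun := gaugeTransformZd k
  invFun := gaugeTransformZd k⁻¹
  left_inv U := by
    show gaugeTransformZd k⁻¹ (gaugeTransformZd k U) = U
    rw [gaugeTransformZd_gaugeTransformZd, inv_mul_cancel, gaugeTransformZd_one]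
  right_inv U := by
    show gaugeTransformZd k (gaugeTransformZd k⁻¹ U) = U
    rw [gaugeTransformZd_gaugeTransformZd, mul_inv_cancel, gaugeTransformZd_one]
  measurable_toFun := measurable_gaugeTransformZd k
  measurable_invFun := measurable_gaugeTransformZd k⁻¹

/-- `⇑(gaugeEquivZd k) = gaugeTransformZd k`. [folklore] -/
@[simp] theorem coe_gaugeEquivZd (k : (Fin d → ℤ) → G) : ⇑(gaugeEquivZd (G := G) k) = gaugeTransformZd k := rfl

variable [SecondCountableTopology G] in
/-- Joint measurability of `(U, g) ↦ U^{ext g}`. [folklore] -/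
theorem measurable_gaugeAction (V : Finset (Fin d → ℤ)) :
    Measurable fun p : LGConfig d G × (↥V → G) => gaugeTransformZd (gaugeExt V p.2) p.1 :=
  (continuous_gaugeAction V).measurable

variable [CompactSpace G]

/-- **THE GAUGE AVERAGE.** `Av_V F (U) = ∫_{G^V} F(U^{ext g}) ∏_{x ∈ V} dg_x`: the average of an observable over
the gauge transformations supported on the finite vertex set `V ⊂ ℤ^d`, against the product of normalised Haar
measures (the infinite-lattice, finite-support version of the Haar average over a gauge group; cf. the slice version
`gaugeAverage` of `MassGapGaugeInvariantClass` for the mass-gap clause). [folklore] -/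
noncomputable def gaugeAvg (V : Finset (Fin d → ℤ)) (F : LGConfig d G → ℝ) (U : LGConfig d G) : ℝ :=
  ∫ g, F (gaugeTransformZd (gaugeExt V g) U) ∂Measure.pi fun _ : ↥V => haarProbability G

/-- The gauge average of a bounded observable obeys the same bound. [folklore] -/
theorem abs_gaugeAvg_le {V : Finset (Fin d → ℤ)} {F : LGConfig d G → ℝ} {C : ℝ} (hC : ∀ U, |F U| ≤ C)
    (U : LGConfig d G) : |gaugeAvg V F U| ≤ C := by
  have h := norm_integral_le_of_norm_le_const (μ := Measure.pi fun _ : ↥V => haarProbability G)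
    (f := fun g : ↥V → G => F (gaugeTransformZd (gaugeExt V g) U)) (C := C)
    (Eventually.of_forall fun g => by simpa only [Real.norm_eq_abs] using hC _)
  simpa only [Real.norm_eq_abs, gaugeAvg, probReal_univ, mul_one] using h

/-- The gauge average of an `S`-cylinder observable is an `S`-cylinder observable. [folklore] -/
theorem isCylinder_gaugeAvg {V : Finset (Fin d → ℤ)} {F : LGConfig d G → ℝ} {S : Finset (ZdEdge d)}
    (hF : IsCylinder F S) : IsCylinder (gaugeAvg V F) S := fun U U' hUU' => by
  unfold gaugeAvg
  exact integral_congr_ae (ae_of_all _ fun g => (isCylinder_comp_gaugeTransformZd hF (gaugeExt V g)) hUU')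

/-- The gauge average of a gauge-invariant observable is the observable. [folklore] -/
theorem gaugeAvg_of_isZdGaugeInvariant (V : Finset (Fin d → ℤ)) {F : LGConfig d G → ℝ} (hF : IsZdGaugeInvariant F) :
    gaugeAvg V F = F := by
  funext U
  simp only [gaugeAvg, hF _ U, integral_const, smul_eq_mul, probReal_univ, one_mul]

/-- **The gauge average is gauge invariant** as soon as `V` contains the vertices of the support: `Av F (U^k) =
∫ F(U^{(ext g) k}) dg = ∫ F(U^{ext (g · k|_V)}) dg = Av F (U)` by locality and the right invariance of Haar measure on
the compact group `G^V`. [folklore] -/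
theorem isZdGaugeInvariant_gaugeAvg {V : Finset (Fin d → ℤ)} {F : LGConfig d G → ℝ} {S : Finset (ZdEdge d)}
    (hF : IsCylinder F S) (hSV : cylVertices S ⊆ V) : IsZdGaugeInvariant (gaugeAvg V F) := by
  intro k U
  simp only [gaugeAvg, gaugeTransformZd_gaugeTransformZd]
  have h : ∀ g : ↥V → G, F (gaugeTransformZd (gaugeExt V g * k) U) =
      F (gaugeTransformZd (gaugeExt V (g * fun x : ↥V => k x)) U) := fun g =>
    gaugeTransformZd_congr_of_isCylinder hF (fun x hx => by simp [gaugeExt, hSV hx]) U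
  simp_rw [h]
  exact integral_mul_right_eq_self (μ := Measure.pi fun _ : ↥V => haarProbability G)
    (fun g => F (gaugeTransformZd (gaugeExt V g) U)) fun x : ↥V => k x

variable [SecondCountableTopology G]

/-- The gauge average of a measurable observable is measurable (Fubini measurability of a parametric integral).
[folklore] -/
theorem measurable_gaugeAvg (V : Finset (Fin d → ℤ)) {F : LGConfig d G → ℝ} (hF : Measurable F) :
    Measurable (gaugeAvg V F) := by
  have h : StronglyMeasurable fun p : LGConfig d G × (↥V → G) => F (gaugeTransformZd (gaugeExt V p.2) p.1) :=
    (hF.comp (measurable_gaugeAction V)).stronglyMeasurable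
  exact (h.integral_prod_right' (ν := Measure.pi fun _ : ↥V => haarProbability G)).measurable

/-- The gauge average of a continuous observable is continuous (a parametric integral of a jointly continuous
integrand over the compact group `G^V`). [folklore] -/
theorem continuous_gaugeAvg (V : Finset (Fin d → ℤ)) {F : LGConfig d G → ℝ} (hF : Continuous F) :
    Continuous (gaugeAvg V F) := by
  have h := continuous_parametric_integral_of_continuous (μ := Measure.pi fun _ : ↥V => haarProbability G)
    (f := fun (U : LGConfig d G) (g : ↥V → G) => F (gaugeTransformZd (gaugeExt V g) U))
    (hF.comp (continuous_gaugeAction V)) isCompact_univ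
  simp only [Measure.restrict_univ] at h
  exact h

/-- **Fubini: a gauge-invariant probability measure does not distinguish an observable from its gauge average.**
[folklore] -/
theorem integral_gaugeAvg_eq {μ : Measure (LGConfig d G)} [IsProbabilityMeasure μ]
    (hμ : ∀ k : (Fin d → ℤ) → G, μ.map (gaugeTransformZd k) = μ) (V : Finset (Fin d → ℤ)) {F : LGConfig d G → ℝ}
    (hFm : Measurable F) (hFb : ∃ C, ∀ U, |F U| ≤ C) : ∫ U, gaugeAvg V F U ∂μ = ∫ U, F U ∂μ := by
  obtain ⟨C, hC⟩ := hFb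
  set π : Measure (↥V → G) := Measure.pi fun _ : ↥V => haarProbability G with hπ
  have hk : ∀ g : ↥V → G, ∫ U, F (gaugeTransformZd (gaugeExt V g) U) ∂μ = ∫ U, F U ∂μ := fun g => by
    rw [← integral_map (measurable_gaugeTransformZd (gaugeExt V g)).aemeasurable hFm.aestronglyMeasurable, hμ]
  have hint : Integrable (fun p : LGConfig d G × (↥V → G) => F (gaugeTransformZd (gaugeExt V p.2) p.1))
      (μ.prod π) :=
    (integrable_const C).mono' (hFm.comp (measurable_gaugeAction V)).aestronglyMeasurable
      (ae_of_all _ fun p => by simpa only [Real.norm_eq_abs] using hC _)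
  calc ∫ U, gaugeAvg V F U ∂μ = ∫ U, ∫ g, F (gaugeTransformZd (gaugeExt V g) U) ∂π ∂μ := rfl
    _ = ∫ g, ∫ U, F (gaugeTransformZd (gaugeExt V g) U) ∂μ ∂π := integral_integral_swap hint
    _ = ∫ g, ∫ U, F U ∂μ ∂π := by simp_rw [hk]
    _ = ∫ U, F U ∂μ := by rw [integral_const, smul_eq_mul, probReal_univ, one_mul]

end GaugeAverage

/-! ## PART C — FINITE VOLUME: THE TORUS STATE DOES NOT SEE THE GAUGE AVERAGE -/

section FiniteVolume

variable {d N : ℕ} {G : Type*} [Group G] [TopologicalSpace G] [IsTopologicalGroup G] [CompactSpace G]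
  [MeasurableSpace G] [BorelSpace G] [SecondCountableTopology G] (ρ : G →* Matrix (Fin N) (Fin N) ℂ)

/-- **`⟨Av F⟩_{𝕋_L} = ⟨F⟩_{𝕋_L}`** for a bounded measurable `S`-cylinder `F` on every torus into which the vertices of
`S` project injectively: exchange the Haar average with the torus expectation (Fubini) and use the gauge invariance
of the torus state term by term. [cite: Wilson1974, §III.B (3.27)-(3.29)] -/
theorem wilsonExpectation_toTorusObservable_gaugeAvg {L : ℕ} [NeZero L] (hρ : Continuous ρ) (β : ℝ)
    {F : LGConfig d G → ℝ} {S : Finset (ZdEdge d)} (hF : IsCylinder F S) (hFm : Measurable F)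
    (hFb : ∃ C, ∀ U, |F U| ≤ C) (hinj : Set.InjOn (Torus.proj (d := d) L) (cylVertices S : Set (Fin d → ℤ))) :
    wilsonExpectation ρ β (toTorusObservable L (gaugeAvg (cylVertices S) F)) =
      wilsonExpectation ρ β (toTorusObservable L F) := by
  haveI := isProbabilityMeasure_wilsonMeasure (d := d) (L := L) ρ hρ β
  obtain ⟨C, hC⟩ := hFb
  set V := cylVertices S with hV
  set π : Measure (↥V → G) := Measure.pi fun _ : ↥V => haarProbability G with hπ
  have hg : ∀ g : ↥V → G, ∫ W, F (gaugeTransformZd (gaugeExt V g) (torusLift L W)) ∂wilsonMeasure ρ β =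
      ∫ W, F (torusLift L W) ∂wilsonMeasure ρ β := fun g => by
    have h1 := wilsonExpectation_toTorusObservable_comp_gaugeTransformZd (L := L) ρ β hF hinj (gaugeExt V g)
    simpa only [wilsonExpectation, toTorusObservable, Function.comp_apply] using h1
  have hint : Integrable (fun p : GaugeConfig d L G × (↥V → G) =>
      F (gaugeTransformZd (gaugeExt V p.2) (torusLift L p.1))) ((wilsonMeasure ρ β).prod π) := by
    refine (integrable_const C).mono' ?_ (ae_of_all _ fun p => by simpa only [Real.norm_eq_abs] using hC _)
    exact (hFm.comp ((measurable_gaugeAction V).comp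
      (((measurable_torusLift L).comp measurable_fst).prodMk measurable_snd))).aestronglyMeasurable
  calc wilsonExpectation ρ β (toTorusObservable L (gaugeAvg V F))
      = ∫ W, ∫ g, F (gaugeTransformZd (gaugeExt V g) (torusLift L W)) ∂π ∂wilsonMeasure ρ β := rfl
    _ = ∫ g, ∫ W, F (gaugeTransformZd (gaugeExt V g) (torusLift L W)) ∂wilsonMeasure ρ β ∂π :=
        integral_integral_swap hint
    _ = ∫ g, ∫ W, F (torusLift L W) ∂wilsonMeasure ρ β ∂π := by simp_rw [hg]
    _ = ∫ W, F (torusLift L W) ∂wilsonMeasure ρ β := by rw [integral_const, smul_eq_mul, probReal_univ, one_mul]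
    _ = wilsonExpectation ρ β (toTorusObservable L F) := rfl

/-- **`⟨Av F⟩_{𝕋_{L+1}} = ⟨F⟩_{𝕋_{L+1}}` for all large `L`.** [cite: Wilson1974, §III.B (3.27)-(3.29)] -/
theorem eventually_wilsonExpectation_gaugeAvg (hρ : Continuous ρ) (β : ℝ) {F : LGConfig d G → ℝ}
    {S : Finset (ZdEdge d)} (hF : IsCylinder F S) (hFm : Measurable F) (hFb : ∃ C, ∀ U, |F U| ≤ C) :
    ∀ᶠ L : ℕ in atTop, wilsonExpectation (L := L + 1) ρ β (toTorusObservable (L + 1) (gaugeAvg (cylVertices S) F)) =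
      wilsonExpectation (L := L + 1) ρ β (toTorusObservable (L + 1) F) :=
  (eventually_injOn_torusProj_sites (cylVertices S)).mono fun _ hL =>
    wilsonExpectation_toTorusObservable_gaugeAvg ρ hρ β hF hFm hFb hL

end FiniteVolume

/-! ## PART D — THE SCHEMAS -/

namespace Balaban1983to89.Missing

open Literature.MathematicalPhysics.QuantumLattice (toTorusObservable)

variable {G : Type*} [Group G] {N : ℕ} (ρ : G →* Matrix (Fin N) (Fin N) ℂ)
  [TopologicalSpace G] [CompactSpace G] [IsTopologicalGroup G] [MeasurableSpace G] [BorelSpace G]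

/-- **`(3)⁰_ginv` — THE THERMODYNAMIC LIMIT OF THE GAUGE-INVARIANT LOCAL ALGEBRA**: every bounded measurable local
observable of the `ℤ^d` theory WHICH IS GAUGE INVARIANT has a limit of its torus expectations along the full
sequence of tori `𝕋_{L+1}`.  The "physical" reading of Jaffe–Witten's (3) (only gauge-invariant quantities are
observable).  By `hasGaugeInvariantTorusLimits_iff_hasTorusLimits` it is EQUIVALENT to the tree's `HasTorusLimits`
(all bounded measurable local observables) — restricting to the gauge-invariant class is NOT a weakening for
periodic boundary conditions.  A `Prop`-valued schema; nothing is asserted. [cite: arXiv180301950, §2 p.5] -/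
def HasGaugeInvariantTorusLimits (d : ℕ) (β : ℝ) : Prop :=
  ∀ F : LGConfig d G → ℝ, IsLocalObservable F → Measurable F → (∃ C, ∀ U, |F U| ≤ C) → IsZdGaugeInvariant F →
    ∃ ℓ : ℝ, Tendsto (fun L : ℕ => wilsonExpectation (L := L + 1) ρ β (toTorusObservable (L + 1) F)) atTop (𝓝 ℓ)

/-- **DENSITY SCHEMA**: the real linear span of the class `𝒲` of observables is UNIFORMLY DENSE in the gauge-invariant
bounded continuous cylinder observables — every such `F` is, for every `ε > 0`, within `ε` in sup norm of an element
of `span_ℝ 𝒲`.  The SHAPE of T. Lévy's theorem (J. Geom. Phys. 52 (2004), Thm 3.1: for `G` a finite product of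
`U(n), SU(n), O(n), SO(n), Sp(n)` and any finite graph, the algebra generated by the Wilson loops of ALL
finite-dimensional representations is dense in the continuous functions on `G^E/G^V`; Abstract: for `G` orthogonal
`O(n)`, unitary or symplectic the loops in the natural representation suffice — v1.1 (XREAD D1): NOT for `SO(2n)` in
its natural representation, where conjugation by a reflection defeats it; kernel witness for `SO(2)` in module XX)
transported to cylinder observables of `ℤ^d`.  A `Prop`-valued schema used as a HYPOTHESIS; nothing is asserted and
Lévy's theorem is NOT formalised here (module XX PROVES the instance `𝒲 = wilsonLoopProducts u1Rep d`).
[cite: Levy2004, Thm 3.1 p.5] -/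
def SpansGaugeInvariantCylinders (d : ℕ) (𝒲 : Set (LGConfig d G → ℝ)) : Prop :=
  ∀ (F : LGConfig d G → ℝ) (S : Finset (ZdEdge d)), IsCylinder F S → Continuous F → (∃ C, ∀ U, |F U| ≤ C) →
    IsZdGaugeInvariant F → ∀ ε : ℝ, 0 < ε → ∃ W ∈ Submodule.span ℝ 𝒲, ∀ U, |F U - W U| ≤ ε

end Balaban1983to89.Missing

open Balaban1983to89.Missing (HasGaugeInvariantTorusLimits SpansGaugeInvariantCylinders)

/-! ## PART E — THE KERNEL THEOREMS -/

section GaugeInvariantClass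

variable {d N : ℕ} {G : Type*} [Group G] [TopologicalSpace G] [IsTopologicalGroup G] [CompactSpace G]
  [MeasurableSpace G] [BorelSpace G] [SecondCountableTopology G] (ρ : G →* Matrix (Fin N) (Fin N) ℂ)

/-- **HEADLINE 1 — `(3)⁰_ginv ⟺ HasTorusLimits`: restricting the thermodynamic-limit requirement to GAUGE-INVARIANT
local observables changes nothing.**  `⇐` is trivial; `⇒`: the torus states are gauge invariant, so for every bounded
measurable `S`-cylinder `F` the torus expectations of `F` and of its gauge average `Av F` (a gauge-invariant bounded
measurable `S`-cylinder) AGREE for all large tori (`eventually_wilsonExpectation_gaugeAvg`); an eventually equal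
sequence has the same limit.  Every real `β`, every `d`, every compact metrisable `G`, every continuous `ρ`.
[cite: arXiv180301950, §2 p.5] -/
theorem hasGaugeInvariantTorusLimits_iff_hasTorusLimits (hρ : Continuous ρ) (β : ℝ) :
    HasGaugeInvariantTorusLimits ρ d β ↔ HasTorusLimits d ρ β := by
  refine ⟨fun h F hFloc hFm hFb => ?_, fun h F hFloc hFm hFb _ => h F hFloc hFm hFb⟩
  obtain ⟨S, hFS⟩ := hFloc
  obtain ⟨ℓ, hℓ⟩ := h (gaugeAvg (cylVertices S) F) ⟨S, isCylinder_gaugeAvg hFS⟩ (measurable_gaugeAvg _ hFm)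
    (hFb.imp fun C hC U => abs_gaugeAvg_le hC U) (isZdGaugeInvariant_gaugeAvg hFS subset_rfl)
  exact ⟨ℓ, hℓ.congr' (eventually_wilsonExpectation_gaugeAvg ρ hρ β hFS hFm hFb)⟩

variable [T2Space G]

/-- **HEADLINE 2 — `(3a) ⟺ (3)⁰_ginv`**: the unique infinite-volume limit of the torus states exists iff every
gauge-invariant bounded measurable local observable has a thermodynamic limit (PART A of module XVIII composed with
HEADLINE 1). [cite: JaffeWittenClay2006, fn. 2 p.12] -/
theorem hasUniqueInfiniteVolumeLimit_iff_hasGaugeInvariantTorusLimits (hρ : Continuous ρ) (β : ℝ) :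
    HasUniqueInfiniteVolumeLimit (d := d) ρ β ↔ HasGaugeInvariantTorusLimits ρ d β := by
  rw [hasGaugeInvariantTorusLimits_iff_hasTorusLimits ρ hρ, hasUniqueInfiniteVolumeLimit_iff_hasTorusLimits ρ hρ]

/-- `(3)⁰_ginv ⟺ (D_B^{TV,0})`: the gauge-invariant class joins module XVIII's ONE-TARGET list. [folklore] -/
theorem hasGaugeInvariantTorusLimits_iff_condDensityTVCauchy (hρ : Continuous ρ) (β : ℝ) :
    HasGaugeInvariantTorusLimits ρ d β ↔ HasCondDensityTVCauchy ρ d β := by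
  rw [← hasUniqueInfiniteVolumeLimit_iff_hasGaugeInvariantTorusLimits ρ hρ,
    hasUniqueInfiniteVolumeLimit_iff_condDensityTVCauchy ρ hρ]

/-- **Every infinite-volume limit point of the torus states is gauge invariant** (`μ ∘ (U ↦ U^k)⁻¹ = μ` for every
`k : ℤ^d → G`): along the subsequence the torus expectations of `F ∘ (U ↦ U^k)` and of `F` agree for large tori and
converge (module XVIII, strong limit points) to `∫ F∘(U ↦ U^k) dμ` and `∫ F dμ`; uniqueness from the continuous
cylinder integrals (tree). [folklore] -/
theorem map_gaugeTransformZd_of_mem_infiniteVolumeLimitPoints (hρ : Continuous ρ) {β : ℝ}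
    {μ : Measure (LGConfig d G)} (hμ : μ ∈ infiniteVolumeLimitPoints (d := d) ρ β) (k : (Fin d → ℤ) → G) :
    μ.map (gaugeTransformZd k) = μ := by
  obtain ⟨φ, hφ, hμφ⟩ := hμ
  haveI : IsProbabilityMeasure μ := hμφ.1
  haveI : IsProbabilityMeasure (μ.map (gaugeTransformZd k)) :=
    Measure.isProbabilityMeasure_map (measurable_gaugeTransformZd k).aemeasurable
  refine measure_eq_of_integral_cylinder_eq fun F S hFS hFc hFb => ?_
  rw [integral_map (measurable_gaugeTransformZd k).aemeasurable hFc.aestronglyMeasurable]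
  have h1 := tendsto_wilsonExpectation_of_isInfiniteVolumeLimitAlong ρ hρ hφ hμφ (F ∘ gaugeTransformZd k) S
    (isCylinder_comp_gaugeTransformZd hFS k) (hFc.measurable.comp (measurable_gaugeTransformZd k)) (hFb.imp fun C hC U => hC _)
  have h2 := tendsto_wilsonExpectation_of_isInfiniteVolumeLimitAlong ρ hρ hφ hμφ F S hFS hFc.measurable hFb
  have h3 : ∀ᶠ n : ℕ in atTop, wilsonExpectation (L := φ n + 1) ρ β
      (toTorusObservable (φ n + 1) (F ∘ gaugeTransformZd k)) =
      wilsonExpectation (L := φ n + 1) ρ β (toTorusObservable (φ n + 1) F) :=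
    hφ.tendsto_atTop.eventually (eventually_wilsonExpectation_comp_gaugeTransformZd ρ β hFS k)
  exact tendsto_nhds_unique (h1.congr' h3) h2

/-- **Gauge-invariant probability measures on `G^{edges(ℤ^d)}` are determined by the gauge-invariant bounded
CONTINUOUS cylinder observables**: replace any bounded continuous cylinder `F` by its (gauge-invariant, continuous,
bounded, cylinder) gauge average under both integrals (`integral_gaugeAvg_eq`), then use the tree's uniqueness from
continuous cylinder integrals (the averaging argument of Sengupta 1994, Thm 4, on the infinite lattice).
[cite: Sengupta1994, Thm 4 pp.903-904] -/
theorem measure_eq_of_integral_gaugeInvariant_eq {μ₁ μ₂ : Measure (LGConfig d G)} [IsProbabilityMeasure μ₁]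
    [IsProbabilityMeasure μ₂] (h₁ : ∀ k : (Fin d → ℤ) → G, μ₁.map (gaugeTransformZd k) = μ₁)
    (h₂ : ∀ k : (Fin d → ℤ) → G, μ₂.map (gaugeTransformZd k) = μ₂)
    (h : ∀ (F : LGConfig d G → ℝ) (S : Finset (ZdEdge d)), IsCylinder F S → Continuous F →
      (∃ C, ∀ U, |F U| ≤ C) → IsZdGaugeInvariant F → ∫ U, F U ∂μ₁ = ∫ U, F U ∂μ₂) :
    μ₁ = μ₂ :=
  measure_eq_of_integral_cylinder_eq fun F S hFS hFc hFb => by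
    rw [← integral_gaugeAvg_eq h₁ (cylVertices S) hFc.measurable hFb,
      ← integral_gaugeAvg_eq h₂ (cylVertices S) hFc.measurable hFb]
    exact h _ S (isCylinder_gaugeAvg hFS) (continuous_gaugeAvg _ hFc) (hFb.imp fun C hC U => abs_gaugeAvg_le hC U)
      (isZdGaugeInvariant_gaugeAvg hFS subset_rfl)

/-- **HEADLINE 3 — `(3a)` ⟺ ALL LIMIT POINTS AGREE ON THE GAUGE-INVARIANT BOUNDED CONTINUOUS CYLINDER OBSERVABLES.**
(Module XVIII: `(3a)` iff the limit-point set is a singleton; limit points are gauge-invariant probability measures,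
and those are separated by the gauge-invariant class.) [cite: arXiv180301950, §2 p.5] -/
theorem hasUniqueInfiniteVolumeLimit_iff_limitPoints_agree_gaugeInvariant (hρ : Continuous ρ) (β : ℝ) :
    HasUniqueInfiniteVolumeLimit (d := d) ρ β ↔
      ∀ μ ∈ infiniteVolumeLimitPoints (d := d) ρ β, ∀ ν ∈ infiniteVolumeLimitPoints (d := d) ρ β,
        ∀ (F : LGConfig d G → ℝ) (S : Finset (ZdEdge d)), IsCylinder F S → Continuous F →
          (∃ C, ∀ U, |F U| ≤ C) → IsZdGaugeInvariant F → ∫ U, F U ∂μ = ∫ U, F U ∂ν := by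
  rw [hasUniqueInfiniteVolumeLimit_iff_subsingleton_limitPoints ρ hρ]
  refine ⟨fun hsub μ hμ ν hν F S _ _ _ _ => by rw [hsub hμ hν], fun h μ hμ ν hν => ?_⟩
  obtain ⟨φ, -, hμφ⟩ := id hμ
  obtain ⟨ψ, -, hνψ⟩ := id hν
  haveI : IsProbabilityMeasure μ := hμφ.1
  haveI : IsProbabilityMeasure ν := hνψ.1
  exact measure_eq_of_integral_gaugeInvariant_eq (map_gaugeTransformZd_of_mem_infiniteVolumeLimitPoints ρ hρ hμ)
    (map_gaugeTransformZd_of_mem_infiniteVolumeLimitPoints ρ hρ hν) (h μ hμ ν hν)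

/-- **HEADLINE 4 — DENSE-CLASS REDUCTION.**  If `𝒲` is a class of bounded measurable local observables whose real
span is uniformly dense in the gauge-invariant bounded continuous cylinder observables (`SpansGaugeInvariantCylinders`,
the shape of Lévy's theorem), then `(3a)` holds iff EVERY MEMBER OF `𝒲` has a thermodynamic limit of its torus
expectations.  `⇒`: members of `𝒲` are bounded measurable local observables (XVIII).  `⇐`: two limit points agree on
`𝒲` (each member converges along the full sequence, hence along both subsequences), on `span 𝒲` by linearity, on the
gauge-invariant continuous cylinders by density, hence coincide (HEADLINE 3). [cite: Levy2004, Thm 3.1 p.5] -/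
theorem hasUniqueInfiniteVolumeLimit_iff_tendsto_of_spans (hρ : Continuous ρ) (β : ℝ) {𝒲 : Set (LGConfig d G → ℝ)}
    (h𝒲 : ∀ W ∈ 𝒲, IsLocalObservable W ∧ Measurable W ∧ ∃ C, ∀ U, |W U| ≤ C)
    (hdense : SpansGaugeInvariantCylinders d 𝒲) :
    HasUniqueInfiniteVolumeLimit (d := d) ρ β ↔
      ∀ W ∈ 𝒲, ∃ ℓ : ℝ,
        Tendsto (fun L : ℕ => wilsonExpectation (L := L + 1) ρ β (toTorusObservable (L + 1) W)) atTop (𝓝 ℓ) := by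
  constructor
  · intro h W hW
    obtain ⟨hWloc, hWm, hWb⟩ := h𝒲 W hW
    exact (hasUniqueInfiniteVolumeLimit_iff_hasTorusLimits ρ hρ β).1 h W hWloc hWm hWb
  intro hlim
  rw [hasUniqueInfiniteVolumeLimit_iff_limitPoints_agree_gaugeInvariant ρ hρ]
  intro μ hμ ν hν F S hFS hFc hFb hFg
  obtain ⟨φ, hφ, hμφ⟩ := hμ
  obtain ⟨ψ, hψ, hνψ⟩ := hν
  haveI : IsProbabilityMeasure μ := hμφ.1
  haveI : IsProbabilityMeasure ν := hνψ.1
  -- the two limit points agree on `span 𝒲`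
  have hagree : ∀ W ∈ Submodule.span ℝ 𝒲, Integrable W μ ∧ Integrable W ν ∧ ∫ U, W U ∂μ = ∫ U, W U ∂ν := by
    intro W hW
    induction hW using Submodule.span_induction with
    | mem W hW =>
      obtain ⟨⟨S', hWS'⟩, hWm, hWb⟩ := h𝒲 W hW
      obtain ⟨ℓ, hℓ⟩ := hlim W hW
      have hμW := tendsto_wilsonExpectation_of_isInfiniteVolumeLimitAlong ρ hρ hφ hμφ W S' hWS' hWm hWb
      have hνW := tendsto_wilsonExpectation_of_isInfiniteVolumeLimitAlong ρ hρ hψ hνψ W S' hWS' hWm hWb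
      obtain ⟨C, hC⟩ := hWb
      refine ⟨(integrable_const C).mono' hWm.aestronglyMeasurable
          (ae_of_all _ fun U => by simpa only [Real.norm_eq_abs] using hC U),
        (integrable_const C).mono' hWm.aestronglyMeasurable
          (ae_of_all _ fun U => by simpa only [Real.norm_eq_abs] using hC U), ?_⟩
      exact (tendsto_nhds_unique hμW (hℓ.comp hφ.tendsto_atTop)).trans
        (tendsto_nhds_unique hνW (hℓ.comp hψ.tendsto_atTop)).symm
    | zero => exact ⟨integrable_zero _ _ _, integrable_zero _ _ _, by simp⟩
    | add W₁ W₂ _ _ h₁ h₂ =>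
      refine ⟨h₁.1.add h₂.1, h₁.2.1.add h₂.2.1, ?_⟩
      simp only [Pi.add_apply]
      rw [integral_add h₁.1 h₂.1, integral_add h₁.2.1 h₂.2.1, h₁.2.2, h₂.2.2]
    | smul c W _ hW' =>
      refine ⟨hW'.1.smul c, hW'.2.1.smul c, ?_⟩
      simp only [Pi.smul_apply, smul_eq_mul]
      rw [integral_const_mul, integral_const_mul, hW'.2.2]
  -- hence on `F`, up to any `ε > 0`
  obtain ⟨C, hC⟩ := hFb
  have hFi : ∀ (κ : Measure (LGConfig d G)) [IsProbabilityMeasure κ], Integrable F κ := fun κ _ =>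
    (integrable_const C).mono' hFc.aestronglyMeasurable (ae_of_all _ fun U => by simpa only [Real.norm_eq_abs] using hC U)
  have key : ∀ ε : ℝ, 0 < ε → |∫ U, F U ∂μ - ∫ U, F U ∂ν| ≤ 2 * ε := fun ε hε => by
    obtain ⟨W, hWspan, hWε⟩ := hdense F S hFS hFc ⟨C, hC⟩ hFg ε hε
    obtain ⟨hWμ, hWν, hWeq⟩ := hagree W hWspan
    have est : ∀ (κ : Measure (LGConfig d G)) [IsProbabilityMeasure κ], Integrable W κ →
        |∫ U, F U ∂κ - ∫ U, W U ∂κ| ≤ ε := fun κ _ hWκ => by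
      rw [← integral_sub (hFi κ) hWκ]
      have h := norm_integral_le_of_norm_le_const (μ := κ) (f := fun U => F U - W U) (C := ε)
        (ae_of_all _ fun U => by simpa only [Real.norm_eq_abs] using hWε U)
      simpa only [Real.norm_eq_abs, probReal_univ, mul_one] using h
    have e1 := est μ hWμ
    have e2 := est ν hWν
    rw [hWeq] at e1
    calc |∫ U, F U ∂μ - ∫ U, F U ∂ν|
        ≤ |∫ U, F U ∂μ - ∫ U, W U ∂ν| + |∫ U, W U ∂ν - ∫ U, F U ∂ν| := abs_sub_le _ _ _
      _ ≤ 2 * ε := by rw [abs_sub_comm (∫ U, W U ∂ν)]; linarith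
  by_contra hne
  have hpos : 0 < |∫ U, F U ∂μ - ∫ U, F U ∂ν| := abs_pos.2 (sub_ne_zero.2 hne)
  have := key (|∫ U, F U ∂μ - ∫ U, F U ∂ν| / 4) (by positivity)
  linarith

end GaugeInvariantClass

/-! ## PART F — THE WILSON-LOOP DICTIONARY (Lévy's class, typed; density as a hypothesis) -/

section WilsonLoopClass

variable {d N : ℕ} {G : Type*} [Group G] (ρ : G →* Matrix (Fin N) (Fin N) ℂ)

/-- A Wilson-loop GENERATOR: the real (`true`) or imaginary (`false`) part of the trace `tr ρ(U_ℓ)` of the holonomy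
of a loop `ℓ` of `ℤ^d` (a closed nearest-neighbour walk with its base point; tree `walkHolonomy`, `wilsonLoopObs`).
[cite: Levy2004, Thm 3.1 p.5] -/
noncomputable def loopFactor : (Σ x : (Fin d → ℤ), (zdGraph d).Walk x x) × Bool → LGConfig d G → ℝ
  | (ℓ, true) => wilsonLoopObs (fun g => (ρ g).trace.re) ℓ.2
  | (ℓ, false) => wilsonLoopObs (fun g => (ρ g).trace.im) ℓ.2

/-- A finite PRODUCT of Wilson-loop generators (`1` for the empty list) — the elements whose real span is the real
algebra generated by the Wilson loops in the representation `ρ`. [cite: Levy2004, Thm 3.1 p.5] -/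
noncomputable def loopProduct (l : List ((Σ x : (Fin d → ℤ), (zdGraph d).Walk x x) × Bool)) (U : LGConfig d G) : ℝ :=
  (l.map fun p => loopFactor ρ p U).prod

/-- **Lévy's class on `ℤ^d`**: all finite products of real and imaginary parts of Wilson-loop traces in the
representation `ρ`. [cite: Levy2004, Thm 3.1 p.5] -/
def wilsonLoopProducts (d : ℕ) : Set (LGConfig d G → ℝ) := Set.range (loopProduct (d := d) ρ)

/-- `loopProduct ρ [] = 1`. [folklore] -/
@[simp] theorem loopProduct_nil : loopProduct (d := d) ρ [] = fun _ => 1 := by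
  funext U; simp [loopProduct]

/-- `loopProduct ρ (p :: l) = loopFactor ρ p * loopProduct ρ l`. [folklore] -/
@[simp] theorem loopProduct_cons (p : (Σ x : (Fin d → ℤ), (zdGraph d).Walk x x) × Bool)
    (l : List ((Σ x : (Fin d → ℤ), (zdGraph d).Walk x x) × Bool)) :
    loopProduct ρ (p :: l) = fun U => loopFactor ρ p U * loopProduct ρ l U := by
  funext U; simp [loopProduct]

/-- Every generator is a local observable. [folklore] -/
theorem isLocalObservable_loopFactor (p : (Σ x : (Fin d → ℤ), (zdGraph d).Walk x x) × Bool) :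
    IsLocalObservable (loopFactor (d := d) ρ p) := by
  rcases p with ⟨ℓ, _ | _⟩
  · exact ⟨_, isCylinder_wilsonLoopObs (fun g => (ρ g).trace.im) ℓ.2⟩
  · exact ⟨_, isCylinder_wilsonLoopObs (fun g => (ρ g).trace.re) ℓ.2⟩

/-- Every product of generators is a local observable (support: the union of the loop supports). [folklore] -/
theorem isLocalObservable_loopProduct :
    ∀ l : List ((Σ x : (Fin d → ℤ), (zdGraph d).Walk x x) × Bool), IsLocalObservable (loopProduct (d := d) ρ l)
  | [] => ⟨∅, fun U U' _ => by simp⟩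
  | p :: l => by
    classical
    obtain ⟨S₁, h₁⟩ := isLocalObservable_loopFactor ρ p
    obtain ⟨S₂, h₂⟩ := isLocalObservable_loopProduct l
    refine ⟨S₁ ∪ S₂, fun U U' hUU' => ?_⟩
    simp only [loopProduct_cons]
    rw [h₁ fun e he => hUU' e (by simp only [Finset.coe_union, Set.mem_union]; exact Or.inl he),
      h₂ fun e he => hUU' e (by simp only [Finset.coe_union, Set.mem_union]; exact Or.inr he)]

variable [TopologicalSpace G] [IsTopologicalGroup G]

/-- Every generator is continuous (for continuous `ρ`). [folklore] -/
theorem continuous_loopFactor (hρ : Continuous ρ) (p : (Σ x : (Fin d → ℤ), (zdGraph d).Walk x x) × Bool) :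
    Continuous (loopFactor (d := d) ρ p) := by
  rcases p with ⟨ℓ, _ | _⟩
  · exact continuous_wilsonLoopObs (Complex.continuous_im.comp hρ.matrix_trace) ℓ.2
  · exact continuous_wilsonLoopObs (Complex.continuous_re.comp hρ.matrix_trace) ℓ.2

/-- Every product of generators is continuous (for continuous `ρ`). [folklore] -/
theorem continuous_loopProduct (hρ : Continuous ρ) :
    ∀ l : List ((Σ x : (Fin d → ℤ), (zdGraph d).Walk x x) × Bool), Continuous (loopProduct (d := d) ρ l)
  | [] => by rw [loopProduct_nil]; exact continuous_const
  | p :: l => by rw [loopProduct_cons]; exact (continuous_loopFactor ρ hρ p).mul (continuous_loopProduct hρ l)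

variable [CompactSpace G]

omit [IsTopologicalGroup G] in
/-- Every generator is bounded (compact `G`, continuous `ρ`). [folklore] -/
theorem exists_abs_loopFactor_le (hρ : Continuous ρ) (p : (Σ x : (Fin d → ℤ), (zdGraph d).Walk x x) × Bool) :
    ∃ C, ∀ U, |loopFactor (d := d) ρ p U| ≤ C := by
  rcases p with ⟨ℓ, _ | _⟩
  · exact exists_abs_wilsonLoopObs_le (Complex.continuous_im.comp hρ.matrix_trace) ℓ.2
  · exact exists_abs_wilsonLoopObs_le (Complex.continuous_re.comp hρ.matrix_trace) ℓ.2

omit [IsTopologicalGroup G] in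
/-- Every product of generators is bounded. [folklore] -/
theorem exists_abs_loopProduct_le (hρ : Continuous ρ) :
    ∀ l : List ((Σ x : (Fin d → ℤ), (zdGraph d).Walk x x) × Bool), ∃ C, ∀ U, |loopProduct (d := d) ρ l U| ≤ C
  | [] => ⟨1, fun U => by simp⟩
  | p :: l => by
    obtain ⟨C₁, h₁⟩ := exists_abs_loopFactor_le ρ hρ p
    obtain ⟨C₂, h₂⟩ := exists_abs_loopProduct_le hρ l
    refine ⟨C₁ * C₂, fun U => ?_⟩
    rw [loopProduct_cons, abs_mul]
    exact mul_le_mul (h₁ U) (h₂ U) (abs_nonneg _) ((abs_nonneg _).trans (h₁ U))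

variable [MeasurableSpace G] [BorelSpace G] [SecondCountableTopology G]

/-- **`(3a)` ⟺ EVERY WILSON-LOOP CORRELATION HAS A THERMODYNAMIC LIMIT — under Lévy's density as a hypothesis.**
If the real span of the Wilson-loop products in the representation `ρ` is uniformly dense in the gauge-invariant
bounded continuous cylinder observables of `ℤ^d` (hypothesis `SpansGaugeInvariantCylinders d (wilsonLoopProducts ρ
d)`: the shape of Lévy 2004, Abstract / Sengupta 1994 Thm 2 for `G ∈ {U(n), SU(n), O(n), SO(2n+1), Sp(n)}` with `ρ`
the natural representation — v1.1 (XREAD D1): v1 wrote `SO(n)`; for `SO(2n)` with `ρ` natural the hypothesis is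
false (`d ≥ 2`), and Lévy's Thm 3.1 proper uses all representations),
then the torus states have a unique infinite-volume limit iff for every finite list of loops the torus expectation
of the product of the real/imaginary parts of their traces converges as `L → ∞`.  What must converge is the family of
JOINT MOMENTS of the Wilson loops (loop correlations), not only the single-loop expectations.
[cite: Levy2004, Thm 3.1 p.5] -/
theorem hasUniqueInfiniteVolumeLimit_iff_wilsonLoopProductLimits [T2Space G] (hρ : Continuous ρ) (β : ℝ)
    (hdense : SpansGaugeInvariantCylinders d (wilsonLoopProducts ρ d)) :
    HasUniqueInfiniteVolumeLimit (d := d) ρ β ↔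
      ∀ l : List ((Σ x : (Fin d → ℤ), (zdGraph d).Walk x x) × Bool), ∃ ℓ : ℝ,
        Tendsto (fun L : ℕ => wilsonExpectation (L := L + 1) ρ β (toTorusObservable (L + 1) (loopProduct ρ l)))
          atTop (𝓝 ℓ) := by
  have h𝒲 : ∀ W ∈ wilsonLoopProducts ρ d, IsLocalObservable W ∧ Measurable W ∧ ∃ C, ∀ U, |W U| ≤ C := by
    rintro W ⟨l, rfl⟩
    exact ⟨isLocalObservable_loopProduct ρ l, (continuous_loopProduct ρ hρ l).measurable,
      exists_abs_loopProduct_le ρ hρ l⟩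
  rw [hasUniqueInfiniteVolumeLimit_iff_tendsto_of_spans ρ hρ β h𝒲 hdense]
  simp only [wilsonLoopProducts, Set.forall_mem_range]

end WilsonLoopClass

/-! ### The Wilson-loop correlation schema and the volume-Cauchy form of the missing estimate -/

namespace Balaban1983to89.Missing

open Literature.MathematicalPhysics.QuantumLattice (toTorusObservable)

variable {G : Type*} [Group G] {N : ℕ} (ρ : G →* Matrix (Fin N) (Fin N) ℂ)
  [TopologicalSpace G] [CompactSpace G] [IsTopologicalGroup G] [MeasurableSpace G] [BorelSpace G]

/-- **`(W-corr)` — THERMODYNAMIC LIMIT OF ALL WILSON-LOOP CORRELATIONS**: for every finite list of loops of `ℤ^d`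
(each tagged real/imaginary part), the torus expectation `⟨∏ᵢ Re/Im tr ρ(U_{ℓᵢ})⟩_{𝕋_{L+1},β}` converges as
`L → ∞`.  NECESSARY for `(3a)` unconditionally (`hasWilsonLoopCorrelationLimits_of_hasUniqueInfiniteVolumeLimit`);
SUFFICIENT under Lévy's density (`hasUniqueInfiniteVolumeLimit_iff_hasWilsonLoopCorrelationLimits`).  The published
large-`β` and small-`β` expansions control exactly such quantities, uniformly in the volume; what `(3a)` asks in addition is
their CONVERGENCE (equivalently: Cauchy in the volume, `hasWilsonLoopCorrelationLimits_iff_cauchySeq`).  A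
`Prop`-valued schema; nothing is asserted. [cite: arXiv180301950, §2 p.5] -/
def HasWilsonLoopCorrelationLimits (d : ℕ) (β : ℝ) : Prop :=
  ∀ l : List ((Σ x : (Fin d → ℤ), (zdGraph d).Walk x x) × Bool), ∃ ℓ : ℝ,
    Tendsto (fun L : ℕ => wilsonExpectation (L := L + 1) ρ β (toTorusObservable (L + 1) (loopProduct ρ l)))
      atTop (𝓝 ℓ)

end Balaban1983to89.Missing

open Balaban1983to89.Missing (HasWilsonLoopCorrelationLimits)

section WilsonLoopCorrelations

variable {d N : ℕ} {G : Type*} [Group G] [TopologicalSpace G] [IsTopologicalGroup G] [CompactSpace G]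
  [MeasurableSpace G] [BorelSpace G] (ρ : G →* Matrix (Fin N) (Fin N) ℂ)

/-- **THE VOLUME-CAUCHY FORM.** `(W-corr)` iff for every finite list of loops the sequence of torus expectations
`L ↦ ⟨∏ᵢ Re/Im tr ρ(U_{ℓᵢ})⟩_{𝕋_{L+1},β}` is CAUCHY (`ℝ` is complete): the missing input is an estimate
`|⟨W⟩_{𝕋_L} - ⟨W⟩_{𝕋_{L'}}| ≤ ε_W(min(L, L'))`, `ε_W → 0`, for Wilson-loop correlations `W` — convergence IN the
volume, not a bound UNIFORM in the volume. [folklore] -/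
theorem hasWilsonLoopCorrelationLimits_iff_cauchySeq (β : ℝ) :
    HasWilsonLoopCorrelationLimits ρ d β ↔
      ∀ l : List ((Σ x : (Fin d → ℤ), (zdGraph d).Walk x x) × Bool),
        CauchySeq fun L : ℕ => wilsonExpectation (L := L + 1) ρ β (toTorusObservable (L + 1) (loopProduct ρ l)) :=
  forall_congr' fun _ => ⟨fun ⟨_, h⟩ => h.cauchySeq, fun h => cauchySeq_tendsto_of_complete h⟩

variable [SecondCountableTopology G] [T2Space G]

/-- **`(3a) ⟹ (W-corr)`, unconditionally**: Wilson-loop correlations are bounded measurable local observables, so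
module XVIII's `(3a) ⟹ HasTorusLimits` applies. [cite: arXiv180301950, §2 p.5] -/
theorem hasWilsonLoopCorrelationLimits_of_hasUniqueInfiniteVolumeLimit (hρ : Continuous ρ) (β : ℝ)
    (h : HasUniqueInfiniteVolumeLimit (d := d) ρ β) : HasWilsonLoopCorrelationLimits ρ d β := fun l =>
  (hasUniqueInfiniteVolumeLimit_iff_hasTorusLimits ρ hρ β).1 h _ (isLocalObservable_loopProduct ρ l)
    (continuous_loopProduct ρ hρ l).measurable (exists_abs_loopProduct_le ρ hρ l)

/-- **`(3a) ⟺ (W-corr)` UNDER LÉVY'S DENSITY** (restatement of `hasUniqueInfiniteVolumeLimit_iff_wilsonLoopProductLimits`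
through the schema). [cite: Levy2004, Thm 3.1 p.5] -/
theorem hasUniqueInfiniteVolumeLimit_iff_hasWilsonLoopCorrelationLimits (hρ : Continuous ρ) (β : ℝ)
    (hdense : SpansGaugeInvariantCylinders d (wilsonLoopProducts ρ d)) :
    HasUniqueInfiniteVolumeLimit (d := d) ρ β ↔ HasWilsonLoopCorrelationLimits ρ d β :=
  hasUniqueInfiniteVolumeLimit_iff_wilsonLoopProductLimits ρ hρ β hdense

end WilsonLoopCorrelations

end Literature.MathematicalPhysics.QuantumFieldTheory
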